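import Mathlib
import HarnessLib
import Literature.MathematicalPhysics.StatisticalMechanics.LinearisedMapABKM
import Literature.MathematicalPhysics.StatisticalMechanics.StepOperatorBABKM
import Literature.MathematicalPhysics.StatisticalMechanics.PolymerProductBound

/-!
# The integration map `R_{k+1}` on arbitrary polymers and the four-factor product bound
# ([ABKM19] Lemma 8.4 for `X ∈ 𝓟_k`, Lemma 8.3 (iii))

Two small abstract-to-concrete bricks of the `P₁`/`R₁` estimates of [ABKM19] Ch. 9:

* **`tayNormLE_fluct_abkm`** — Lemma 8.4 (`ℓ = 0`) for the torus tower on an ARBITRARY `k`-polymer `X`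
  and an arbitrary gauge `T`: `|R_{k+1}F|_{T, w_{k:k+1}^X} ≤ A_𝒫^{|X|_k} |F|_{T, w_k^X}`
  (`LinearisedMapABKM.integrationProperty_abkm` is the same statement packaged for connected `X` and the
  gauge `T_k^{X*}`; the map `R₁` of Ch. 9 acts on all polymers);
* **`tayNormLE_mul_four`** — `|Φ₁Φ₂Φ₃Φ₄|_{T,w} ≤ c₁c₂c₃c₄` for four functionals bounded in norms with
  gauges `≤ T` and weights `w₁w₂w₃w₄ ≤ w` (Lemma 8.3 (iii) with the block products and the polymer
  factor as black boxes — the form used for the hybrid terms of the Lipschitz estimate of `P₁`).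

Everything is proved; no named fact.

## References
* S. Adams, S. Buchholz, R. Kotecký, S. Müller, arXiv:1910.13564, Lemma 8.4 (8.4), Lemma 8.3 (iii)
  [AdamsBuchholzKoteckyMuller2019].
-/

noncomputable section

namespace Literature.MathematicalPhysics.StatisticalMechanics.GradientRG

open scoped BigOperators
open Finset MeasureTheory
open Literature.MathematicalPhysics.StatisticalMechanics.TorusPolymer (IsPolymer numBlocks)
open Literature.MathematicalPhysics.StatisticalMechanics.GradientFRD (fourierCoeff cExt)
open Literature.MathematicalPhysics.QuantumFieldTheory

variable {d M : ℕ} [NeZero M]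

/-- **Lemma 8.4 (`ℓ = 0`) on an arbitrary `k`-polymer, for the torus tower**: for `θ̄, λ > 0`,
`AbkmWeightBounds`, `k + 1 ≤ N + 1`, any gauge `T`, and a `T`-local `C^{r₀}` functional with
`|F|_{T, w_k^X} ≤ C` (`C ≥ 0`): `|R_{k+1}F|_{T, w_{k:k+1}^X} ≤ C A_𝒫^{|X|_k}`.
[cite: AdamsBuchholzKoteckyMuller2019, Lemma 8.4 (8.4)] -/
theorem tayNormLE_fluct_abkm {L N Mord R n : ℕ} {θbar lam μ δ₁ δ₀ A𝒫 : ℝ}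
    {𝒞 : ℕ → (Fin d → ZMod M) → ℝ} (hθbar : 0 < θbar) (hlam : 0 < lam)
    (hB : AbkmWeightBounds L N Mord R n θbar lam μ δ₁ δ₀ A𝒫 𝒞
      (abkmWeightData L N Mord R θbar (schedDelta δ₀ δ₁ N) 𝒞))
    {k : ℕ} (hk : k + 1 ≤ N + 1) {X : Finset (Fin d → ZMod M)} (hX : IsPolymer (L ^ k) X)
    {V : Type*} [NormedAddCommGroup V] [NormedSpace ℝ V] (T : ((Fin d → ZMod M) → ℝ) →ₗ[ℝ] V)
    {r₀ : ℕ} {F : ((Fin d → ZMod M) → ℝ) → ℂ} {C : ℝ} (hC : 0 ≤ C) (hFd : ContDiff ℝ r₀ F)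
    (hFloc : IsGaugeLocal T F)
    (hF : TayNormLE T r₀ ((abkmWeightData L N Mord R θbar (schedDelta δ₀ δ₁ N) 𝒞).weight k X) F C) :
    TayNormLE T r₀ ((abkmWeightData L N Mord R θbar (schedDelta δ₀ δ₁ N) 𝒞).midWeight k X)
      (fluct (𝒞 (k + 1)) F) (C * A𝒫 ^ numBlocks (L ^ k) X) := by
  set W := abkmWeightData L N Mord R θbar (schedDelta δ₀ δ₁ N) 𝒞 with hW
  have heven_all : ∀ j ∈ Icc 1 (N + 1), ∀ x, 𝒞 j (-x) = 𝒞 j x := fun j hj => (hB.zero_sum_even j hj).2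
  have heven : ∀ x, 𝒞 (k + 1) (-x) = 𝒞 (k + 1) x := heven_all (k + 1) (mem_Icc.2 ⟨by omega, hk⟩)
  have hdom := weightSectionDominated_abkm hθbar hlam hB hk X T
  have hw7 : ∀ φ, ∫ ξ, W.weight k X (φ + ξ) ∂(stepMeasure (𝒞 (k + 1))) ≤
      A𝒫 ^ numBlocks (L ^ k) X * W.midWeight k X φ := fun φ => by
    rw [integral_stepMeasure (continuous_weight_comp_add _ k X φ)]
    exact hB.integral k hk X hX φ
  exact hF.integral_comp_add_section hC hFd hFloc hdom
    (integrable_weight_abkm hθbar.le hB.dominated hB.multipliers_nonneg hk heven X) hw7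

section Four

variable {V : Type*} [NormedAddCommGroup V] [NormedSpace ℝ V]

/-- **Four-factor submultiplicativity** ([ABKM19] Lemma 8.3 (iii) with black-box factors): bounds
`|Φᵢ|_{Tᵢ, wᵢ} ≤ cᵢ` (`cᵢ ≥ 0`, `Tᵢ ≤ T`, `Tᵢ`-local `C^{r₀}` factors) and `w₁w₂(w₃w₄) ≤ w` give
`|Φ₁Φ₂(Φ₃Φ₄)|_{T,w} ≤ c₁c₂(c₃c₄)`. [cite: AdamsBuchholzKoteckyMuller2019, Lemma 8.3 (iii)] -/
theorem tayNormLE_mul_four {T : ((Fin d → ZMod M) → ℝ) →ₗ[ℝ] V} {r₀ : ℕ} {w : ((Fin d → ZMod M) → ℝ) → ℝ}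
    {V₁ V₂ V₃ V₄ : Type*} [NormedAddCommGroup V₁] [NormedSpace ℝ V₁] [NormedAddCommGroup V₂]
    [NormedSpace ℝ V₂] [NormedAddCommGroup V₃] [NormedSpace ℝ V₃] [NormedAddCommGroup V₄]
    [NormedSpace ℝ V₄] {T₁ : ((Fin d → ZMod M) → ℝ) →ₗ[ℝ] V₁} {T₂ : ((Fin d → ZMod M) → ℝ) →ₗ[ℝ] V₂}
    {T₃ : ((Fin d → ZMod M) → ℝ) →ₗ[ℝ] V₃} {T₄ : ((Fin d → ZMod M) → ℝ) →ₗ[ℝ] V₄}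
    {w₁ w₂ w₃ w₄ : ((Fin d → ZMod M) → ℝ) → ℝ} {Φ₁ Φ₂ Φ₃ Φ₄ : ((Fin d → ZMod M) → ℝ) → ℂ}
    {c₁ c₂ c₃ c₄ : ℝ}
    (h₁ : TayNormLE T₁ r₀ w₁ Φ₁ c₁) (h₂ : TayNormLE T₂ r₀ w₂ Φ₂ c₂) (h₃ : TayNormLE T₃ r₀ w₃ Φ₃ c₃)
    (h₄ : TayNormLE T₄ r₀ w₄ Φ₄ c₄)
    (hle₁ : ∀ ξ, ‖T₁ ξ‖ ≤ ‖T ξ‖) (hle₂ : ∀ ξ, ‖T₂ ξ‖ ≤ ‖T ξ‖) (hle₃ : ∀ ξ, ‖T₃ ξ‖ ≤ ‖T ξ‖)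
    (hle₄ : ∀ ξ, ‖T₄ ξ‖ ≤ ‖T ξ‖)
    (hd₁ : ContDiff ℝ r₀ Φ₁) (hd₂ : ContDiff ℝ r₀ Φ₂) (hd₃ : ContDiff ℝ r₀ Φ₃) (hd₄ : ContDiff ℝ r₀ Φ₄)
    (hl₁ : IsGaugeLocal T₁ Φ₁) (hl₂ : IsGaugeLocal T₂ Φ₂) (hl₃ : IsGaugeLocal T₃ Φ₃) (hl₄ : IsGaugeLocal T₄ Φ₄)
    (hc₁ : 0 ≤ c₁) (hc₂ : 0 ≤ c₂) (hc₃ : 0 ≤ c₃) (hc₄ : 0 ≤ c₄)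
    (hw : ∀ φ, w₁ φ * w₂ φ * (w₃ φ * w₄ φ) ≤ w φ) :
    TayNormLE T r₀ w (Φ₁ * Φ₂ * (Φ₃ * Φ₄)) (c₁ * c₂ * (c₃ * c₄)) := by
  have h12 := TayNormLE.mul (T := T) (w := fun φ => w₁ φ * w₂ φ) h₁ h₂ hle₁ hle₂ hd₁ hd₂ hl₁ hl₂ hc₁ hc₂
    (fun φ => le_rfl)
  have h34 := TayNormLE.mul (T := T) (w := fun φ => w₃ φ * w₄ φ) h₃ h₄ hle₃ hle₄ hd₃ hd₄ hl₃ hl₄ hc₃ hc₄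
    (fun φ => le_rfl)
  exact TayNormLE.mul (T := T) (w := w) h12 h34 (fun ξ => le_rfl) (fun ξ => le_rfl) (hd₁.mul hd₂)
    (hd₃.mul hd₄) ((hl₁.of_norm_le hle₁).mul (hl₂.of_norm_le hle₂))
    ((hl₃.of_norm_le hle₃).mul (hl₄.of_norm_le hle₄)) (mul_nonneg hc₁ hc₂) (mul_nonneg hc₃ hc₄) hw

end Four

end Literature.MathematicalPhysics.StatisticalMechanics.GradientRG

end
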